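import Summits.ResolutionOfSingularities.ResolutionOfSingularities.Theorems.FrobeniusLadderFInjectiveMacaulayficationPointFixableCentre
import HarnessLib

/-!
# Spreading a stalk centre to an ideal sheaf (`centreSpread`, CurveStageSig §C1)

[OURS · L1 W4.5a] Support file for crux stmt-ResolutionOfSingularities-15315
(`FrobeniusLadder.FInjectiveMacaulayfication`), hole #3β local-currency signature `CurveStageSig.lean` of
res-L1-w45a-strat-1 (RULING R12.38 of res-L1-w45a-plan-1: SIG OF RECORD), item §C1 `stub_centreSpread`, statement
VERBATIM (the `stub_` prefix dropped). It is the NON-PRIMARY twin of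
`PointCentreIdealSheaf.stub_pointCentreIdealSheaf` / `PointFixableCentre.pointFixable_h4`: there the centre
`(c) ⊆ 𝒪_{X,b}` is `𝔪_b`-primary at a closed point and the spread has support `{b}`; here `η` is ANY point of a
Noetherian scheme and `(c)` is any non-zero proper ideal of `𝒪_{X,η}`, and only `J ≠ ⊥`, `η ∈ supp J`, `J_η = (c)`
are recorded (the consumer, §C3 `closedLocusStep_of_locFix_of_fc` of res-D-pv-019 AS stub-7, takes `Z := supp J`).

Construction (folklore bookkeeping over Mathlib's `AlgebraicGeometry.IdealSheaf` API, exactly as in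
`PointCentreIdealSheaf`): pick an affine open `U ∋ η`; the germ map `Γ(X, U) → 𝒪_{X,η}` is the localization at
the prime `𝔭_η` (`IsAffineOpen.isLocalization_stalk`), so the contraction `Ĩ := (c) ∩ Γ(X, U)` satisfies
`Ĩ·𝒪_{X,η} = (c)` (`IsLocalization.map_under`); `J` is the kernel (`Scheme.Hom.ker`) of
`Spec (Γ(X, U) ⧸ Ĩ) ⟶ Spec Γ(X, U) ⟶ X`, whose sections over `U` are `Ĩ`
(`PointCentreIdealSheaf.ker_app_SpecMap_comp_fromSpec` + `Scheme.Hom.ker_apply`, the source being a Noetherian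
space), hence `J_η = Ĩ·𝒪_{X,η} = (c)` (`stalkIdeal_eq_map_germ`); `η ∈ supp J` because `J_η = (c) ⊆ 𝔪_η`
(`mem_support_iff_stalkIdeal_le`), and `J ≠ ⊥` because `J_η = (c) ≠ ⊥`.

References: The Stacks Project, Tags 01J3, 01R8 (closed subschemes, ideal sheaves, scheme-theoretic support);
no statement of Hironaka 2017 is used; no definition is declared; AI-written (AI review is weaker than expert review).
[folklore]
-/

-- single-problem summit: the doubled namespace component `ResolutionOfSingularities` is forced
set_option linter.dupNamespace false

noncomputable section

namespace Summit.ResolutionOfSingularities.ResolutionOfSingularities.Theorems.FInjectiveMacaulayfication.CentreSpread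

open AlgebraicGeometry CategoryTheory TopologicalSpace IsLocalRing Literature.AlgebraicGeometry.Resolution
open Summit.ResolutionOfSingularities.ResolutionOfSingularities.Theorems.FInjectiveMacaulayfication

/-- **The ideal sheaf generated by an ideal given on one affine chart.** For an affine open `U` of a locally
Noetherian scheme `X` and an ideal `I ⊆ Γ(X, U)` there is an ideal sheaf `J` on `X` with `J(U) = I`, namely the
kernel of `Spec (Γ(X, U) ⧸ I) ⟶ Spec Γ(X, U) ⟶ X`. [folklore] -/
theorem exists_idealSheafData_ideal_eq (X : Scheme.{0}) [IsLocallyNoetherian X] (U : X.affineOpens)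
    (I : Ideal Γ(X, U)) : ∃ J : X.IdealSheafData, J.ideal U = I := by
  -- the quotient map `q : Γ(X, U) ⟶ Γ(X, U) ⧸ I` and its kernel
  obtain ⟨q, hq⟩ : ∃ q : Γ(X, U) ⟶ CommRingCat.of (Γ(X, U) ⧸ I),
      q = CommRingCat.ofHom (Ideal.Quotient.mk I) := ⟨_, rfl⟩
  have hkq : RingHom.ker q.hom = I := by rw [hq, CommRingCat.hom_ofHom, Ideal.mk_ker]
  -- the source of `Spec q ≫ fromSpec : Spec (Γ(X, U) ⧸ I) ⟶ X` is a Noetherian space, so the map is quasi-compact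
  haveI : IsNoetherianRing Γ(X, U) := IsLocallyNoetherian.component_noetherian U
  haveI : NoetherianSpace (Spec (CommRingCat.of (Γ(X, U) ⧸ I))) := inferInstance
  refine ⟨(Spec.map q ≫ U.2.fromSpec).ker, ?_⟩
  rw [Scheme.Hom.ker_apply]
  exact (PointCentreIdealSheaf.ker_app_SpecMap_comp_fromSpec U.2 q).trans hkq

/-- §C1 [OURS · L1 W4.5a] **SPREADING A STALK CENTRE** (`CurveStageSig.lean` §C1 `stub_centreSpread` VERBATIM;
non-primary version of `PointCentreIdealSheaf.stub_pointCentreIdealSheaf`): on a Noetherian scheme, a non-zero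
proper ideal `(c)` of `𝒪_{X,η}` is the stalk at `η` of an ideal sheaf `J ≠ ⊥` with `η ∈ supp J` — namely the
kernel of `Spec (Γ(X,U) ⧸ Ĩ) ⟶ X` for an affine open `U ∋ η` and `Ĩ = (c) ∩ Γ(X,U)` (`IsLocalization.map_under`
gives `Ĩ·𝒪_η = (c)`). [folklore] -/
theorem centreSpread : ∀ (X : Scheme.{0}) [IsNoetherian X] (η : X) (n : ℕ) (c : Fin n → X.presheaf.stalk η),
    Ideal.span (Set.range c) ≠ ⊥ → Ideal.span (Set.range c) ≤ maximalIdeal (X.presheaf.stalk η) →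
    ∃ J : X.IdealSheafData, J ≠ ⊥ ∧ η ∈ (J.support : Set X) ∧ stalkIdeal J η = Ideal.span (Set.range c) := by
  intro X _ η n c hc0 hcm
  -- an affine open around `η`; the germ map is the localization at `𝔭_η`
  obtain ⟨U₀, hU₀, hηU, -⟩ := exists_isAffineOpen_mem_and_subset (X := X) (x := η) (U := ⊤) (Opens.mem_top η)
  let U : X.affineOpens := ⟨U₀, hU₀⟩
  letI := TopCat.Presheaf.algebra_section_stalk X.presheaf (⟨η, hηU⟩ : (U : X.Opens))
  haveI : IsLocalization.AtPrime (X.presheaf.stalk η) (U.2.primeIdealOf ⟨η, hηU⟩).asIdeal :=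
    U.2.isLocalization_stalk ⟨η, hηU⟩
  -- the contraction `Ĩ = (c) ∩ Γ(X, U)` extends back to `(c)`
  have hmap : ((Ideal.span (Set.range c)).under Γ(X, U)).map (algebraMap Γ(X, U) (X.presheaf.stalk η)) =
      Ideal.span (Set.range c) :=
    IsLocalization.map_under (U.2.primeIdealOf ⟨η, hηU⟩).asIdeal.primeCompl (X.presheaf.stalk η) _
  have hI0 : (Ideal.span (Set.range c)).under Γ(X, U) ≠ ⊥ := fun h =>
    hc0 (by rw [← hmap, h, Ideal.map_bot])
  -- the ideal sheaf with `J(U) = Ĩ`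
  obtain ⟨J, hJU⟩ := exists_idealSheafData_ideal_eq X U ((Ideal.span (Set.range c)).under Γ(X, U))
  -- its stalk at `η` is `Ĩ·𝒪_η = (c)`
  have hst : stalkIdeal J η = Ideal.span (Set.range c) := by
    rw [stalkIdeal_eq_map_germ J U hηU, hJU]
    exact hmap
  refine ⟨J, fun hbot => hI0 ?_, ?_, hst⟩
  · -- `J = ⊥` would force `Ĩ = J(U) = ⊥`
    rw [← hJU, hbot]
    rfl
  · -- `η ∈ supp J` since `J_η = (c) ⊆ 𝔪_η`
    exact (mem_support_iff_stalkIdeal_le J η).mpr (hst ▸ hcm)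

end Summit.ResolutionOfSingularities.ResolutionOfSingularities.Theorems.FInjectiveMacaulayfication.CentreSpread

end
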